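/-
Copyright (c) 2026 the pub-hodgecm-mathlib formalisation cell (harness21).  Prover seat hodgecm-mathlib-A-p03 (g24); LEAD F0P3a-plan (g9) WORD T8-41 «(F4)–(F8) PEN 1»,
architect A-p06 (g26) (MAP v3 §2 (F4)), 2026-09-01.
-/
import Literature.NumberTheory.Automorphic.UnitaryThreeBorelCosetCountQuadratic
import Literature.NumberTheory.Rogawski1990.UnitOrbitalIntegralInertPiecewise
import HarnessLib

/-!
# Flicker's PROPOSITION 10 as a kernel theorem: the `P_H`-coset count of `τ_j` (`j ≥ 1`) equals the printed table `iTen q ν N₊ m`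

Topic `NumberTheory/Rogawski1990` (road «D-N7-inert», MAP v3 (F4), LAYER B of `CENSUS-F4-F8-FlickerCongruenceVolumes.A-p03g24.md`); namespace
`Literature.NumberTheory.Automorphic.UnitaryGroup` (B-p17's frame; ★ defs `flickerPH`, `flickerHK`, `flickerPH0`, `flickerPHRho`).  THEOREMS ONLY: no definition, no
named fact, no instance, no notation, no `sorry`; kernel lane.

THE MATHEMATICS [Flicker1998UnitaryFL, Prop. 10 pp. 85–86].  For `τ = !![A,0,B₂ϖ^{2j}; 0,b,0; B₂,0,A] ∈ H` (the conjugate `r_j⁻¹ t_θ r_j` of a regular type-(1) torus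
element, `j ≥ 1`) with `|B₂| = |ϖ^ν|` (`ν = N − j`) and `|A − b| = |ϖ^{N₊}|`, the number of cosets `y ∈ P_H ⧸ (P_H ∩ H^K_m)` with `y⁻¹ τ y ∈ H^K_m` — the quantity
weighted by `[R_E^× : R_E(j)^×]` in Cor. 9 — is Flicker's table ★ `iTen q ν N₊ m`: `1` (`m = 0`), `(1 − q⁻²)q^{4m}` (`1 ≤ m ≤ min([ν∕2],[N₊∕2])`),
`(1 + q⁻¹)q^{ν+2m}` (`ν = N₊ < 2m ≤ 2ν`), `0` otherwise (**`natCard_cosets_eq_iTen`**).  The six-way dispatch uses the coset counts ★ `natCard_cosets_eq_zero_of_lt`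
(«`m > ν`»), ★ `natCard_cosets_eq_zero_of_ne` («`N₊ < m`» and «`ν ≠ N₊`»), ★ `natCard_cosets_eq_index_of_le` («all»: `m = 0` and `2m ≤ min(ν,N₊)`), ★
`natCard_cosets_regime_four` («`ν = N₊ < 2m`»), with Prop. 8's index `[P_H : P_H ∩ H^K_m] = (q²−1)q^{4m−2}` (`m ≥ 1`; `= 1` at `m = 0`) and the fibre size `[N₀ : P_H ∩ H^K_m] = q^m`
of `ρ_m` ((F3c-β), B-p04 (g33)) entering as the hypotheses `hidx0`, `hidx`, `hSN`, `hfib`.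
HONEST LABEL: HC_CM is proved only modulo the printed citations until rung 0 closes; this file is counting arithmetic (no measure theory, no letter).

## References
* [Flicker1998UnitaryFL] Y. Z. Flicker, *Elementary proof of the fundamental lemma for a unitary group*, Canad. J. Math. 50 (1998), 74–98: Prop. 10 pp. 85–86, Prop. 8 p. 84.
* [Rogawski1990] J. D. Rogawski, *Automorphic Representations of Unitary Groups in Three Variables* (1990), §4.9 p. 55.
-/

set_option autoImplicit false

open scoped MatrixGroups WithZero Valued
open Matrix

namespace Literature.NumberTheory.Automorphic

namespace UnitaryGroup

open Literature.NumberTheory.Automorphic.HermitianLattice (unitaryInt mem_unitaryInt_iff LocalConjDatum)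
open Literature.NumberTheory.Rogawski1990.Flicker1998 (iTen)
open IsLocalRing

variable {K : Type*} [Field K] [Valued K ℤᵐ⁰] {ϖ : K} (σ : K →+* K) {J : Matrix (Fin 3) (Fin 3) K}

/-! ## §1 Exponent bookkeeping for `|ϖ^n|` -/

/-- `|ϖ^a| ≤ |ϖ^b| ↔ b ≤ a`. [cite: Flicker1998UnitaryFL, Prop. 10 p. 85] -/
theorem v_pow_le_v_pow_iff (hd : LocalConjDatum σ ϖ) {a b : ℕ} : Valued.v (ϖ ^ a) ≤ Valued.v (ϖ ^ b) ↔ b ≤ a := by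
  rw [hd.v_pow, hd.v_pow, WithZero.exp_le_exp]; omega

/-- `|ϖ^a| < |ϖ^b| ↔ b < a`. [cite: Flicker1998UnitaryFL, Prop. 10 p. 85] -/
theorem v_pow_lt_v_pow_iff (hd : LocalConjDatum σ ϖ) {a b : ℕ} : Valued.v (ϖ ^ a) < Valued.v (ϖ ^ b) ↔ b < a := by
  rw [hd.v_pow, hd.v_pow, WithZero.exp_lt_exp]; omega

/-- `|ϖ^a| = |ϖ^b| ↔ a = b`. [cite: Flicker1998UnitaryFL, Prop. 10 p. 85] -/
theorem v_pow_eq_v_pow_iff (hd : LocalConjDatum σ ϖ) {a b : ℕ} : Valued.v (ϖ ^ a) = Valued.v (ϖ ^ b) ↔ a = b := by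
  rw [hd.v_pow, hd.v_pow, WithZero.exp_inj]; omega

/-! ## §2 The two `ℚ`-cast identities of the table -/

/-- `(q² − 1)·q^{4m−2} = (1 − q⁻²)·q^{4m}` in `ℚ` (`m ≥ 1`, `q ≠ 0`). [cite: Flicker1998UnitaryFL, Prop. 10 p. 85] -/
theorem cast_index_eq {q m : ℕ} (hq : q ≠ 0) (hm : 1 ≤ m) :
    (((q ^ 2 - 1) * q ^ (4 * m - 2) : ℕ) : ℚ) = (1 - ((q : ℚ) ^ 2)⁻¹) * (q : ℚ) ^ (4 * m) := by
  have hq' : (q : ℚ) ≠ 0 := by exact_mod_cast hq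
  have hq1 : 1 ≤ q ^ 2 := Nat.one_le_pow _ _ (Nat.pos_of_ne_zero hq)
  obtain ⟨m', rfl⟩ : ∃ m', m = m' + 1 := ⟨m - 1, by omega⟩
  rw [show 4 * (m' + 1) - 2 = 4 * m' + 2 by omega, show 4 * (m' + 1) = 4 * m' + 4 by omega]
  push_cast [hq1]
  field_simp
  ring

/-- `q^m·q^m·q^{m−k}·q^{m−1}(q+1) = (1 + q⁻¹)·q^{ν+2m}` in `ℚ` when `m = k + r`, `ν = k + 2r`, `k = k′ + 1` (all exponents written additively). [cite: Flicker1998UnitaryFL, Prop. 10 p. 86] -/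
theorem cast_regime_four_eq {q : ℕ} (hq : q ≠ 0) (k' r : ℕ) :
    ((q ^ (k' + 1 + r) * (q ^ (k' + 1 + r) * (q ^ r * (q ^ (k' + r) * (q + 1)))) : ℕ) : ℚ) =
      (1 + ((q : ℚ))⁻¹) * (q : ℚ) ^ ((k' + 1 + 2 * r) + 2 * (k' + 1 + r)) := by
  have hq' : (q : ℚ) ≠ 0 := by exact_mod_cast hq
  push_cast
  field_simp
  ring

/-! ## §3 PROPOSITION 10 -/

section PropTen

variable [IsDiscreteValuationRing 𝒪[K]] [Finite (ResidueField 𝒪[K])] [IsAdicComplete (maximalIdeal 𝒪[K]) 𝒪[K]]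

/-- **FLICKER'S PROPOSITION 10** (`j ≥ 1`): for `τ = !![A,0,B₂ϖ^{2j}; 0,b,0; B₂,0,A] ∈ H` with `|B₂| = |ϖ^ν|`, `|A − b| = |ϖ^{N₊}|`, the number of cosets
`y ∈ P_H ⧸ (P_H ∩ H^K_m)` with `y⁻¹ τ y ∈ H^K_m` is the printed table ★ `iTen q ν N₊ m` — given Prop. 8's index (`hidx0`, `hidx`) and the fibre size `q^m` of `ρ_m` (`hfib`),
both (F3c-β) (B-p04 (g33)), and the σ-defect bound `hσd` of `d = 2(A−b)∕B₂` in the fourth regime (from ★ `map_ratio_sub_ratio` at the eigenvalues).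
[cite: Flicker1998UnitaryFL, Prop. 10 pp. 85–86] -/
theorem natCard_cosets_eq_iTen (hJ : J = (StdForm.antidiagonal 3).over K) (hd : LocalConjDatum σ ϖ)
    (hσO : ∀ y : 𝒪[K], (σ.comp 𝒪[K].subtype) y ∈ 𝒪[K]) {y : K} (hy : y * σ y = -2)
    {m ν Np j : ℕ} (hj : 1 ≤ j)
    {c um τ : ↥(unitaryGroupOfForm σ J)} (hc : ((c : GL (Fin 3) K) : Matrix (Fin 3) (Fin 3) K) = !![1, 0, 0; 0, -1, 0; 0, 0, 1])
    (hum : ((um : GL (Fin 3) K) : Matrix (Fin 3) (Fin 3) K) = !![ϖ ^ m, y, (ϖ ^ m)⁻¹; 0, 1, -σ y * (ϖ ^ m)⁻¹; 0, 0, (ϖ ^ m)⁻¹])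
    {A B₂ b : K} (hτ : ((τ : GL (Fin 3) K) : Matrix (Fin 3) (Fin 3) K) = !![A, 0, B₂ * ϖ ^ (2 * j); 0, b, 0; B₂, 0, A])
    (hτH : τ ∈ Subgroup.centralizer ({c} : Set ↥(unitaryGroupOfForm σ J)))
    (hB₂ : Valued.v B₂ = Valued.v (ϖ ^ ν)) (hs : Valued.v (A - b) = Valued.v (ϖ ^ Np))
    (hσd : Np = ν → m ≤ ν → ν < 2 * m → Valued.v (σ (2 * (A - b) / B₂) - 2 * (A - b) / B₂) ≤ Valued.v (ϖ ^ (2 * m - ν)))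
    {q : ℕ} (hq : Nat.card (ResidueField 𝒪[K]) = q ^ 2)
    {a₀ : 𝒪[K]} (ha₀ : IsUnit (((σ.comp 𝒪[K].subtype).codRestrict 𝒪[K] hσO) a₀ - a₀))
    (hidx0 : m = 0 → ((flickerHK σ J c um).subgroupOf (flickerPH σ J c)).index = 1)
    (hidx : 1 ≤ m → ((flickerHK σ J c um).subgroupOf (flickerPH σ J c)).index = (q ^ 2 - 1) * q ^ (4 * m - 2))
    (hSN : flickerPH σ J c ⊓ flickerHK σ J c um ≤ flickerPH0 σ J c (ϖ ^ m))
    [Finite (↥(flickerPH σ J c) ⧸ (flickerHK σ J c um).subgroupOf (flickerPH σ J c))]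
    (hfib : ∀ z ∈ Set.range (fun w : ↥(flickerPH σ J c) ⧸ (flickerHK σ J c um).subgroupOf (flickerPH σ J c) =>
        flickerPHRho σ m ((Quotient.out w : ↥(flickerPH σ J c)) : ↥(unitaryGroupOfForm σ J))),
      Nat.card {w : ↥(flickerPH σ J c) ⧸ (flickerHK σ J c um).subgroupOf (flickerPH σ J c) //
        flickerPHRho σ m ((Quotient.out w : ↥(flickerPH σ J c)) : ↥(unitaryGroupOfForm σ J)) = z} = q ^ m) :
    (Nat.card {w : ↥(flickerPH σ J c) ⧸ (flickerHK σ J c um).subgroupOf (flickerPH σ J c) //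
      ((Quotient.out w : ↥(flickerPH σ J c)) : ↥(unitaryGroupOfForm σ J))⁻¹ * τ * (Quotient.out w : ↥(flickerPH σ J c)) ∈ flickerHK σ J c um} : ℚ) =
      iTen q ν Np m := by
  have hq0 : q ≠ 0 := by
    rintro rfl
    have h1 : 0 < Nat.card (ResidueField 𝒪[K]) := Nat.card_pos
    rw [hq] at h1; simp at h1
  have hϖ0 : ϖ ≠ 0 := hd.ϖ_ne_zero
  have hB₂0 : B₂ ≠ 0 := fun h => by
    rw [h, map_zero] at hB₂; exact (pow_ne_zero _ hϖ0) ((map_eq_zero _).1 hB₂.symm)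
  have hvmm : Valued.v (ϖ ^ m) * Valued.v (ϖ ^ m) = Valued.v (ϖ ^ (2 * m)) := by rw [← map_mul, ← pow_add, two_mul]
  rcases Nat.eq_zero_or_pos m with hm0 | hm
  · -- m = 0 : everything solves, one coset
    subst hm0
    have hall := natCard_cosets_eq_index_of_le σ hJ hd hy 0 hc hum (j := j) hτ hτH
      (by rw [hs, hvmm, v_pow_le_v_pow_iff σ hd]; omega) (by rw [hB₂, hvmm, v_pow_le_v_pow_iff σ hd]; omega)
    rw [hall, hidx0 rfl, iTen, if_pos rfl, Nat.cast_one]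
  have hm0 : m ≠ 0 := by omega
  by_cases hνm : ν < m
  · -- regime «m > ν» : empty
    rw [natCard_cosets_eq_zero_of_lt σ hJ hd hy m hc hum hj hB₂0 hτ hτH (by rw [hB₂, v_pow_lt_v_pow_iff σ hd]; exact hνm),
      iTen, if_neg hm0, if_neg (by omega), if_neg (by omega), Nat.cast_zero]
  have hmν : m ≤ ν := by omega
  have hB₂m : Valued.v B₂ ≤ Valued.v (ϖ ^ m) := by rw [hB₂, v_pow_le_v_pow_iff σ hd]; exact hmν
  by_cases hNp : Np < m
  · -- regime «N₊ < m» : no solution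
    rw [natCard_cosets_eq_zero_of_ne σ hJ hd hy m hc hum hj hB₂0 hτ hτH hB₂m
      (Or.inl (by rw [hs, v_pow_lt_v_pow_iff σ hd]; exact hNp)),
      iTen, if_neg hm0, if_neg (by omega), if_neg (by omega), Nat.cast_zero]
  have hmNp : m ≤ Np := by omega
  by_cases hboth : 2 * m ≤ ν ∧ 2 * m ≤ Np
  · -- regime «all» : the full index
    have hall := natCard_cosets_eq_index_of_le σ hJ hd hy m hc hum (j := j) hτ hτH
      (by rw [hs, hvmm, v_pow_le_v_pow_iff σ hd]; exact hboth.2) (by rw [hB₂, hvmm, v_pow_le_v_pow_iff σ hd]; exact hboth.1)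
    rw [hall, hidx hm, cast_index_eq hq0 hm, iTen, if_neg hm0, if_pos (by omega)]
  by_cases hνNp : ν = Np
  · -- regime «ν = N₊ < 2m» : the quadratic count
    subst hνNp
    have hν2m : ν < 2 * m := by omega
    obtain ⟨r, hr⟩ : ∃ r, ν = m + r := ⟨ν - m, by omega⟩
    obtain ⟨k', hk'⟩ : ∃ k', m = k' + 1 + r := ⟨m - r - 1, by omega⟩
    have hreg := natCard_cosets_regime_four σ hJ hd hσO hy (k := k' + 1) hm hmν (by omega) (by omega) hj hc hum hτ hτH hB₂ hs
      (by have := hσd rfl hmν hν2m; rwa [show 2 * m - ν = k' + 1 by omega] at this) hq ha₀ hSN hfib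
    rw [hreg, iTen, if_neg hm0, if_neg (by omega), if_pos ⟨rfl, hν2m, hmν⟩,
      show m - (k' + 1) = r by omega, show m - 1 = k' + r by omega, hk', cast_regime_four_eq hq0 k' r]
    congr 2; omega
  · -- regime «ν ≠ N₊ beyond the square root» : no solution
    have hne : Valued.v (A - b) ≠ Valued.v B₂ := by
      rw [hs, hB₂, Ne, v_pow_eq_v_pow_iff σ hd]; exact fun h => hνNp h.symm
    have hbig : Valued.v (ϖ ^ m) * Valued.v (ϖ ^ m) < max (Valued.v (A - b)) (Valued.v B₂) := by
      rw [hvmm, hs, hB₂]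
      rcases not_and_or.1 hboth with h | h
      · exact lt_max_of_lt_right (by rw [v_pow_lt_v_pow_iff σ hd]; omega)
      · exact lt_max_of_lt_left (by rw [v_pow_lt_v_pow_iff σ hd]; omega)
    rw [natCard_cosets_eq_zero_of_ne σ hJ hd hy m hc hum hj hB₂0 hτ hτH hB₂m (Or.inr ⟨hne, hbig⟩),
      iTen, if_neg hm0, if_neg (by omega), if_neg (by rintro ⟨h, -, -⟩; exact hνNp h), Nat.cast_zero]

end PropTen

end UnitaryGroup

end Literature.NumberTheory.Automorphic
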